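import Mathlib
import Literature.MathematicalPhysics.QuantumLattice.AngularSectors
import Literature.MathematicalPhysics.QuantumLattice.HubbardFermiCurve
import Literature.MathematicalPhysics.QuantumLattice.HubbardBandSectorCountingCounts

/-!
# Shell-inclusion corollaries of the single-scale four-sector counting lemma
(BGM 2006 Lemma 3.1 / App. A2) on the band Fermi curve modulo `2πℤ²`

The tree theorem `Summit.HubbardSuperconductivity.HubbardSuperconductivity.Theorems.stub_fourSectorCount`
(file `ThermalWedgeTwSourcedInertnessFourSectorCount.lean`) counts, for the FREE square-lattice band
`ε(k) = -2(cos k₁ + cos k₂)` at a level `μ` in a compact of `(-4, 0)`, the sector triples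
`(ω₂, ω₃, ω₄)` of angular width `w = π/2ⁿ` admitting momenta of the shell `|ε - μ| ≤ w` with
`k₁ + k₂ + k₃ + k₄ = 2πG`: at most `K·2ⁿ·(n+1)`, uniformly in `G` and `μ`.

Benfatto–Giuliani–Mastropietro (Ann. Henri Poincaré 7 (2006) 809, Lemma 3.1 (3.23) and App. A2
(A2.0), (A2.6)–(A2.7)) state the count for the isotropic sectors of the INTERACTING scale-`h` Fermi
curve of the dispersion `ε_h`, whose shell has a thickness `γ^h e₀` that is a fixed multiple of the
angular width. If `sup |ε_h - ε₀| ≤ δ` on the cell (a `k`-independent shift may be absorbed into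
`μ`), then `{|ε_h - μ| ≤ t} ⊂ {|ε₀ - μ| ≤ t + δ}` and the free-curve count with a THICKER shell applies.
SCOPE (GAP-LEDGER rows D-G-002-ref3 and D-G-002-dag): (2.36) line 1 is the PER-STEP bound; the
cumulative shift is `O(|U|)`, `h`-independent ((2.41a)), its `k`-dependent part `O(|U|²)` — so
`t + δ ≤ c·w` in (b) holds on the ULTRAVIOLET part of the trajectory (`γ^h e₀ ≳ C|U|²`) only: a
citable PARTIAL transfer; the infrared scales need the curve-generic, `C²`-perturbative counting
toolbox (DECOMP S2′, G-002 «CLOSER NAMED»), not claimed here. (Cell `gate-hubbard-kl`, AUDIT-A1A2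
§2 row 2.12.)

* `klsc_cell` — cell geometry for a shell of ARBITRARY thickness `t` (the toolbox lemma
  `BandSectorCounting.cell` has `t = w`): a momentum of the shell `|ε - μ| ≤ t` in the sector `ω` is
  within `t/Dt_min + s_max w/2` of the curve point at the sector centre, coordinatewise;
* `klsc_fourSectorCount_thickShell` — (a) the four-sector count with the shell `|ε - μ| ≤ c·w` for any
  fixed `c > 0` (constant `K = K(μ₁, μ₂, c)`), by the proof of `stub_fourSectorCount` run with the
  cell radius `D_c w`, `D_c = c/Dt_min + s_max/2`, and `count_pairs_exists` at `C_δ = 16 D_c`;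
* `klsc_fourSectorCount_of_subset_shell` — (a′) the same bound for ANY family of leg supports
  `P j ⊆ {|ε₀ - μ| ≤ c·w}` on the open square (inclusion of the counted sets);
* `klsc_fourSectorCount_perturbed` — (b) the perturbed-dispersion form: for every `ε'` with
  `sup_{(-π,π)²} |ε' - ε₀| ≤ δ` and every shell thickness `t` with `t + δ ≤ c·w`, the `ε'`-shell
  count is at most `K·2ⁿ·(n+1)` with the constant of (a) — BGM's `A_h(ε_h) ⊂ A_h(ε₀; thicker shell)`.

No new definitions; no facts assumed.
-/

set_option linter.dupNamespace false

open Classical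

noncomputable section

open Real Set
open Literature.MathematicalPhysics.QuantumLattice
open Literature.MathematicalPhysics.QuantumLattice.BandSectorCounting

namespace Summit.HubbardSuperconductivity.HubbardSuperconductivity.Theorems

/-- **Cell geometry for a shell of arbitrary thickness** (BGM 2003 Lemmas 7.2–7.3 on the band
Fermi curve; the toolbox lemma `BandSectorCounting.cell` is the case `t = w`): a momentum `k` of the
open square in the shell `|ε(k) - μ| ≤ t`, `t ≤ m₀` (`μ ± m₀` in the level range `[a, b]`), whose
polar angle lies in the sector `ω` of width `w = π/2ⁿ`, is within `t/Dt_min + s_max·w/2` of the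
curve point `p_μ(θ_ω)` at the sector centre, coordinatewise — radial deviation `≤ t/Dt_min` by the
Lipschitz dependence of the Fermi radius on the level, angular deviation `≤ s_max·w/2`. -/
theorem klsc_cell {a b : ℝ} (B : BandBounds a b) {μ : ℝ} (hμ : μ ∈ Icc a b)
    {k : Fin 2 → ℝ} {n ω : ℕ} {t m₀ : ℝ} (hk : ∀ i, |k i| < π)
    (hshell : |sqDispersion k - μ| ≤ t) (ht : t ≤ m₀)
    (hlo : a ≤ μ - m₀) (hhi : μ + m₀ ≤ b)
    (hω : sectorIndex n (Complex.arg (⟨k 0, k 1⟩ : ℂ)) = ω) :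
    |k 0 - bandX μ (sectorCenter n ω)| ≤ t / B.Dtmin + B.smax * (sectorWidth n / 2) ∧
      |k 1 - bandY μ (sectorCenter n ω)| ≤ t / B.Dtmin + B.smax * (sectorWidth n / 2) := by
  obtain ⟨h1, h2⟩ := B.level hμ
  set w := sectorWidth n with hwdef
  set ν := sqDispersion k with hν
  have hνeq : eps2 (k 0) (k 1) = ν := by simp [hν, sqDispersion, eps2]
  have hνmem : ν ∈ Icc a b := by
    have := abs_le.1 hshell; constructor <;> linarith
  obtain ⟨hν₁, hν₂⟩ := B.level hνmem
  obtain ⟨hx, hy⟩ := band_eq_of_level hν₁ hν₂ (hk 0).le (hk 1).le hνeq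
  set φ := Complex.arg (⟨k 0, k 1⟩ : ℂ) with hφ
  -- radial deviation
  have hrad := abs_bandFermiRadius_level_sub_le B hνmem hμ φ
  have hradX : |bandX ν φ - bandX μ φ| ≤ t / B.Dtmin := by
    calc |bandX ν φ - bandX μ φ| = |bandFermiRadius ν φ - bandFermiRadius μ φ| * |Real.cos φ| := by
          rw [bandX, bandX, ← sub_mul, abs_mul]
      _ ≤ |bandFermiRadius ν φ - bandFermiRadius μ φ| :=
          mul_le_of_le_one_right (abs_nonneg _) (Real.abs_cos_le_one φ)
      _ ≤ |ν - μ| / B.Dtmin := hrad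
      _ ≤ t / B.Dtmin := div_le_div_of_nonneg_right hshell B.Dtmin_pos.le
  have hradY : |bandY ν φ - bandY μ φ| ≤ t / B.Dtmin := by
    calc |bandY ν φ - bandY μ φ| = |bandFermiRadius ν φ - bandFermiRadius μ φ| * |Real.sin φ| := by
          rw [bandY, bandY, ← sub_mul, abs_mul]
      _ ≤ |bandFermiRadius ν φ - bandFermiRadius μ φ| :=
          mul_le_of_le_one_right (abs_nonneg _) (Real.abs_sin_le_one φ)
      _ ≤ |ν - μ| / B.Dtmin := hrad
      _ ≤ t / B.Dtmin := div_le_div_of_nonneg_right hshell B.Dtmin_pos.le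
  -- angular deviation
  obtain ⟨m, hm⟩ := exists_angleRep_eq_add φ
  have hcen := abs_angleRep_sub_sectorCenter_le n φ
  rw [hω] at hcen
  have hper := band_add_int_mul_two_pi h1 h2 φ m
  rw [← hm] at hper
  have hangX : |bandX μ φ - bandX μ (sectorCenter n ω)| ≤ B.smax * (w / 2) := by
    rw [← hper.1]
    exact (abs_bandX_sub_le B hμ _ _).trans (mul_le_mul_of_nonneg_left hcen B.smax_pos.le)
  have hangY : |bandY μ φ - bandY μ (sectorCenter n ω)| ≤ B.smax * (w / 2) := by
    rw [← hper.2.1]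
    exact (abs_bandY_sub_le B hμ _ _).trans (mul_le_mul_of_nonneg_left hcen B.smax_pos.le)
  constructor
  · calc |k 0 - bandX μ (sectorCenter n ω)|
          = |(bandX ν φ - bandX μ φ) + (bandX μ φ - bandX μ (sectorCenter n ω))| := by
            rw [hx]; ring_nf
      _ ≤ |bandX ν φ - bandX μ φ| + |bandX μ φ - bandX μ (sectorCenter n ω)| := abs_add_le _ _
      _ ≤ t / B.Dtmin + B.smax * (w / 2) := add_le_add hradX hangX
  · calc |k 1 - bandY μ (sectorCenter n ω)|
          = |(bandY ν φ - bandY μ φ) + (bandY μ φ - bandY μ (sectorCenter n ω))| := by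
            rw [hy]; ring_nf
      _ ≤ |bandY ν φ - bandY μ φ| + |bandY μ φ - bandY μ (sectorCenter n ω)| := abs_add_le _ _
      _ ≤ t / B.Dtmin + B.smax * (w / 2) := add_le_add hradY hangY

/-- **(a) The four-sector counting lemma with a shell of thickness `c·w`** (Benfatto–Giuliani–Mastropietro
2006, Lemma 3.1 / App. A2 (A2.0), whose isotropic shell has a thickness `γ^h e₀` proportional to,
not equal to, the angular width): for every fixed `c > 0` and every compact level range
`[μ₁, μ₂] ⊂ (-4, 0)` there is `K = K(μ₁, μ₂, c)` such that, with the sector of one leg fixed, the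
number of sector triples `(ω₂, ω₃, ω₄)` of angular width `w = π/2ⁿ` for which momenta of the open
square in the shell `|ε - μ| ≤ c·w` and in the prescribed sectors can satisfy
`k₁ + k₂ + k₃ + k₄ = 2πG` exactly is at most `K·2ⁿ·(n+1)`, uniformly in `G ∈ ℤ²` and
`μ ∈ [μ₁, μ₂]`. Proof: the fibration scheme of `stub_fourSectorCount` with the cell radius
`D_c w`, `D_c = c/Dt_min + s_max/2` (`klsc_cell`), and `BandSectorCounting.count_pairs_exists`
at tolerance `C_δ = 16 D_c`; small `n` by the trivial bound `N³`. -/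
theorem klsc_fourSectorCount_thickShell (c : ℝ) (hc : 0 < c) :
    ∀ μ₁ μ₂ : ℝ, -4 < μ₁ → μ₁ ≤ μ₂ → μ₂ < 0 → ∃ K : ℝ, 0 < K ∧ ∀ μ ∈ Set.Icc μ₁ μ₂,
      ∀ (n : ℕ) (G : Fin 2 → ℤ) (ω₁ : Fin (sectorCount n)),
        (((Finset.univ : Finset (Fin (sectorCount n) × Fin (sectorCount n) × Fin (sectorCount n))).filter
          (fun ω => ∃ k : Fin 4 → Fin 2 → ℝ, (∀ j i, |k j i| < Real.pi) ∧
            (∀ j, |sqDispersion (k j) - μ| ≤ c * sectorWidth n) ∧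
            sectorIndex n (Complex.arg (⟨k 0 0, k 0 1⟩ : ℂ)) = (ω₁ : ℕ) ∧
            sectorIndex n (Complex.arg (⟨k 1 0, k 1 1⟩ : ℂ)) = (ω.1 : ℕ) ∧
            sectorIndex n (Complex.arg (⟨k 2 0, k 2 1⟩ : ℂ)) = (ω.2.1 : ℕ) ∧
            sectorIndex n (Complex.arg (⟨k 3 0, k 3 1⟩ : ℂ)) = (ω.2.2 : ℕ) ∧
            (∀ i, ∑ j, k j i = 2 * Real.pi * (G i : ℝ)))).card : ℝ) ≤ K * 2 ^ n * ((n : ℝ) + 1) := by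
  intro μ₁ μ₂ hμ₁ h12 hμ₂
  -- the level range `[a', b']` and its uniform bounds
  have ha : -4 < (μ₁ - 4) / 2 := by linarith
  have hab : (μ₁ - 4) / 2 ≤ μ₂ / 2 := by linarith
  have hb : μ₂ / 2 < 0 := by linarith
  obtain ⟨B, -⟩ : ∃ B : BandBounds ((μ₁ - 4) / 2) (μ₂ / 2), B = bandBounds ha hab hb := ⟨_, rfl⟩
  have hm₀ : 0 < min (μ₁ - (μ₁ - 4) / 2) (μ₂ / 2 - μ₂) := lt_min (by linarith) (by linarith)
  obtain ⟨τ, lam, ηo, η₀, η₁, hτ, hτπ, hlam, hηo, hη₀, hη₀m, hη₁, hcov, hodd, heven, hH⟩ :=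
    exists_small_constants B hm₀
  have hDt := B.Dtmin_pos
  have hsmax := B.smax_pos
  -- the cell constant for the thick shell
  obtain ⟨Dc, hDc⟩ : ∃ Dc : ℝ, Dc = c / B.Dtmin + B.smax / 2 := ⟨_, rfl⟩
  have hD : 0 < Dc := by rw [hDc]; positivity
  have hCδ : 0 < 16 * Dc := by positivity
  obtain ⟨Kp, hKp, hcount⟩ := count_pairs_exists B hCδ hτ hτπ hlam hηo hη₀ hη₁ hcov hodd heven hH
  have hum := B.umin_pos
  have hπ := Real.pi_pos
  -- the threshold on `w` and the two constants
  obtain ⟨w₀, hw₀⟩ : ∃ w₀ : ℝ, w₀ = min 1 (min (min (μ₁ - (μ₁ - 4) / 2) (μ₂ / 2 - μ₂) / c)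
    (η₀ / (4 * (16 * Dc)))) := ⟨_, rfl⟩
  have hw₀pos : 0 < w₀ := by rw [hw₀]; exact lt_min (by norm_num) (lt_min (by positivity) (by positivity))
  obtain ⟨C₀, hC₀⟩ : ∃ C₀ : ℝ, C₀ = 3 * (2 * (π * (Real.sqrt 2 * (4 * Dc) / B.umin)) + 1) := ⟨_, rfl⟩
  have hC₀pos : 0 < C₀ := by rw [hC₀]; positivity
  obtain ⟨K₁, hK₁⟩ : ∃ K₁ : ℝ, K₁ = 8 * (π / w₀) ^ 2 := ⟨_, rfl⟩
  obtain ⟨K₂, hK₂⟩ : ∃ K₂ : ℝ, K₂ = C₀ * Kp * 3 / π := ⟨_, rfl⟩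
  have hK₁pos : 0 < K₁ := by rw [hK₁]; positivity
  have hK₂pos : 0 < K₂ := by rw [hK₂]; positivity
  refine ⟨K₁ + K₂, by positivity, ?_⟩
  intro μ hμ n G ω₁
  have hwpos : 0 < sectorWidth n := sectorWidth_pos n
  have hNw : (sectorCount n : ℝ) * sectorWidth n = 2 * π := sectorCount_mul_sectorWidth n
  have h2n : (2 : ℝ) ^ n * sectorWidth n = π := by rw [sectorWidth]; field_simp
  have hNeq : sectorCount n = 2 * 2 ^ n := by unfold sectorCount; ring
  have hNreal : (sectorCount n : ℝ) = 2 * 2 ^ n := by rw [hNeq]; push_cast; ring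
  have hsc : ∀ i : ℕ, sectorCenter n i = sectorWidth n / 2 + i * sectorWidth n := sectorCenter_eq n
  generalize hwdef : sectorWidth n = w at hwpos hNw h2n hsc ⊢
  have hμab : μ ∈ Icc ((μ₁ - 4) / 2) (μ₂ / 2) := ⟨by linarith only [hμ.1, hμ₁], by linarith only [hμ.2, hμ₂]⟩
  have h2npos : (0 : ℝ) < 2 ^ n := by positivity
  have hDcw : c * w / B.Dtmin + B.smax * (w / 2) = Dc * w := by rw [hDc]; ring
  -- the trivial bound `N³`
  have htriv : ∀ (pr : Fin (sectorCount n) × Fin (sectorCount n) × Fin (sectorCount n) → Prop) [DecidablePred pr],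
      ((((Finset.univ : Finset (Fin (sectorCount n) × Fin (sectorCount n) × Fin (sectorCount n))).filter pr).card : ℝ)) ≤
        (sectorCount n : ℝ) ^ 3 := by
    intro pr _
    have h1 := Finset.card_filter_le (Finset.univ : Finset (Fin (sectorCount n) × Fin (sectorCount n) × Fin (sectorCount n))) pr
    rw [Finset.card_univ, Fintype.card_prod, Fintype.card_prod, Fintype.card_fin] at h1
    have : ((((Finset.univ : Finset (Fin (sectorCount n) × Fin (sectorCount n) × Fin (sectorCount n))).filter pr).card : ℝ)) ≤
        ((sectorCount n * (sectorCount n * sectorCount n) : ℕ) : ℝ) := by exact_mod_cast h1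
    calc _ ≤ ((sectorCount n * (sectorCount n * sectorCount n) : ℕ) : ℝ) := this
      _ = (sectorCount n : ℝ) ^ 3 := by push_cast; ring
  by_cases hwle : w ≤ w₀
  · -- the main case
    have hw1 : w ≤ 1 := hwle.trans (by rw [hw₀]; exact min_le_left _ _)
    have hwmc : w ≤ min (μ₁ - (μ₁ - 4) / 2) (μ₂ / 2 - μ₂) / c :=
      hwle.trans (by rw [hw₀]; exact (min_le_right _ _).trans (min_le_left _ _))
    have hwm : c * w ≤ min (μ₁ - (μ₁ - 4) / 2) (μ₂ / 2 - μ₂) := by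
      rw [mul_comm]; exact (le_div_iff₀ hc).1 hwmc
    have hwη : w ≤ η₀ / (4 * (16 * Dc)) :=
      hwle.trans (by rw [hw₀]; exact (min_le_right _ _).trans (min_le_right _ _))
    have h2δ : 16 * Dc * w ≤ η₀ / 2 := by
      have := mul_le_mul_of_nonneg_left hwη hCδ.le
      have e : 16 * Dc * (η₀ / (4 * (16 * Dc))) = η₀ / 4 := by field_simp
      rw [e] at this; linarith only [this, hη₀]
    have hm1 : min (μ₁ - (μ₁ - 4) / 2) (μ₂ / 2 - μ₂) ≤ μ₁ - (μ₁ - 4) / 2 := min_le_left _ _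
    have hm2 : min (μ₁ - (μ₁ - 4) / 2) (μ₂ / 2 - μ₂) ≤ μ₂ / 2 - μ₂ := min_le_right _ _
    have hlo : (μ₁ - 4) / 2 ≤ μ - η₀ := by linarith only [hμ.1, hη₀m, hm1]
    have hhi : μ + η₀ ≤ μ₂ / 2 := by linarith only [hμ.2, hη₀m, hm2]
    have hlom : (μ₁ - 4) / 2 ≤ μ - min (μ₁ - (μ₁ - 4) / 2) (μ₂ / 2 - μ₂) := by linarith only [hμ.1, hm1]
    have hhim : μ + min (μ₁ - (μ₁ - 4) / 2) (μ₂ / 2 - μ₂) ≤ μ₂ / 2 := by linarith only [hμ.2, hm2]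
    -- Step 1: the admissible triples have their centre sums close to `2πG`
    have hsub : (Finset.univ : Finset (Fin (sectorCount n) × Fin (sectorCount n) × Fin (sectorCount n))).filter
        (fun ω => ∃ k : Fin 4 → Fin 2 → ℝ,
        (∀ j i, |k j i| < Real.pi) ∧ (∀ j, |sqDispersion (k j) - μ| ≤ c * w) ∧
        sectorIndex n (Complex.arg (⟨k 0 0, k 0 1⟩ : ℂ)) = (ω₁ : ℕ) ∧
        sectorIndex n (Complex.arg (⟨k 1 0, k 1 1⟩ : ℂ)) = (ω.1 : ℕ) ∧
        sectorIndex n (Complex.arg (⟨k 2 0, k 2 1⟩ : ℂ)) = (ω.2.1 : ℕ) ∧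
        sectorIndex n (Complex.arg (⟨k 3 0, k 3 1⟩ : ℂ)) = (ω.2.2 : ℕ) ∧ (∀ i, ∑ j, k j i = 2 * Real.pi * (G i : ℝ))) ⊆
      (Finset.univ : Finset (Fin (sectorCount n) × Fin (sectorCount n) × Fin (sectorCount n))).filter (fun ω =>
        |bandX μ (w / 2 + ((ω₁ : ℕ) : ℝ) * w) + bandX μ (w / 2 + ((ω.1 : ℕ) : ℝ) * w) + bandX μ (w / 2 + ((ω.2.1 : ℕ) : ℝ) * w) +
            bandX μ (w / 2 + ((ω.2.2 : ℕ) : ℝ) * w) - 2 * π * (G 0 : ℝ)| ≤ 4 * Dc * w ∧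
        |bandY μ (w / 2 + ((ω₁ : ℕ) : ℝ) * w) + bandY μ (w / 2 + ((ω.1 : ℕ) : ℝ) * w) + bandY μ (w / 2 + ((ω.2.1 : ℕ) : ℝ) * w) +
            bandY μ (w / 2 + ((ω.2.2 : ℕ) : ℝ) * w) - 2 * π * (G 1 : ℝ)| ≤ 4 * Dc * w) := by
      intro ω hω
      rw [Finset.mem_filter] at hω
      obtain ⟨-, k, hk, hsh, hi0, hi1, hi2, hi3, hsum⟩ := hω
      have hsh' : ∀ j, |sqDispersion (k j) - μ| ≤ c * sectorWidth n := by rw [hwdef]; exact hsh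
      have hwm' : c * sectorWidth n ≤ min (μ₁ - (μ₁ - 4) / 2) (μ₂ / 2 - μ₂) := by rw [hwdef]; exact hwm
      have c0 := klsc_cell B hμab (hk 0) (hsh' 0) hwm' hlom hhim hi0
      have c1 := klsc_cell B hμab (hk 1) (hsh' 1) hwm' hlom hhim hi1
      have c2 := klsc_cell B hμab (hk 2) (hsh' 2) hwm' hlom hhim hi2
      have c3 := klsc_cell B hμab (hk 3) (hsh' 3) hwm' hlom hhim hi3
      rw [hsc, hwdef, hDcw] at c0 c1 c2 c3
      rw [Finset.mem_filter]
      refine ⟨Finset.mem_univ _, ?_, ?_⟩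
      · have hs := hsum 0
        rw [Fin.sum_univ_four] at hs
        have e : bandX μ (w / 2 + ((ω₁ : ℕ) : ℝ) * w) + bandX μ (w / 2 + ((ω.1 : ℕ) : ℝ) * w) + bandX μ (w / 2 + ((ω.2.1 : ℕ) : ℝ) * w) +
            bandX μ (w / 2 + ((ω.2.2 : ℕ) : ℝ) * w) - 2 * π * (G 0 : ℝ) =
            -(k 0 0 - bandX μ (w / 2 + ((ω₁ : ℕ) : ℝ) * w)) + -(k 1 0 - bandX μ (w / 2 + ((ω.1 : ℕ) : ℝ) * w)) +
            -(k 2 0 - bandX μ (w / 2 + ((ω.2.1 : ℕ) : ℝ) * w)) + -(k 3 0 - bandX μ (w / 2 + ((ω.2.2 : ℕ) : ℝ) * w)) := by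
          rw [← hs]; ring
        rw [e]
        calc _ ≤ |-(k 0 0 - bandX μ (w / 2 + ((ω₁ : ℕ) : ℝ) * w))| + |-(k 1 0 - bandX μ (w / 2 + ((ω.1 : ℕ) : ℝ) * w))| +
              |-(k 2 0 - bandX μ (w / 2 + ((ω.2.1 : ℕ) : ℝ) * w))| + |-(k 3 0 - bandX μ (w / 2 + ((ω.2.2 : ℕ) : ℝ) * w))| := by
              refine (abs_add_le _ _).trans (add_le_add ((abs_add_le _ _).trans (add_le_add (abs_add_le _ _) le_rfl)) le_rfl)
          _ ≤ 4 * Dc * w := by rw [abs_neg, abs_neg, abs_neg, abs_neg]; linarith [c0.1, c1.1, c2.1, c3.1]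
      · have hs := hsum 1
        rw [Fin.sum_univ_four] at hs
        have e : bandY μ (w / 2 + ((ω₁ : ℕ) : ℝ) * w) + bandY μ (w / 2 + ((ω.1 : ℕ) : ℝ) * w) + bandY μ (w / 2 + ((ω.2.1 : ℕ) : ℝ) * w) +
            bandY μ (w / 2 + ((ω.2.2 : ℕ) : ℝ) * w) - 2 * π * (G 1 : ℝ) =
            -(k 0 1 - bandY μ (w / 2 + ((ω₁ : ℕ) : ℝ) * w)) + -(k 1 1 - bandY μ (w / 2 + ((ω.1 : ℕ) : ℝ) * w)) +
            -(k 2 1 - bandY μ (w / 2 + ((ω.2.1 : ℕ) : ℝ) * w)) + -(k 3 1 - bandY μ (w / 2 + ((ω.2.2 : ℕ) : ℝ) * w)) := by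
          rw [← hs]; ring
        rw [e]
        calc _ ≤ |-(k 0 1 - bandY μ (w / 2 + ((ω₁ : ℕ) : ℝ) * w))| + |-(k 1 1 - bandY μ (w / 2 + ((ω.1 : ℕ) : ℝ) * w))| +
              |-(k 2 1 - bandY μ (w / 2 + ((ω.2.1 : ℕ) : ℝ) * w))| + |-(k 3 1 - bandY μ (w / 2 + ((ω.2.2 : ℕ) : ℝ) * w))| := by
              refine (abs_add_le _ _).trans (add_le_add ((abs_add_le _ _).trans (add_le_add (abs_add_le _ _) le_rfl)) le_rfl)
          _ ≤ 4 * Dc * w := by rw [abs_neg, abs_neg, abs_neg, abs_neg]; linarith [c0.2, c1.2, c2.2, c3.2]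
    -- Step 2: eliminate the last index
    have hr : 0 ≤ 4 * Dc * w := by positivity
    have hT'le : ((((Finset.univ : Finset (Fin (sectorCount n) × Fin (sectorCount n) × Fin (sectorCount n))).filter (fun ω =>
        |bandX μ (w / 2 + ((ω₁ : ℕ) : ℝ) * w) + bandX μ (w / 2 + ((ω.1 : ℕ) : ℝ) * w) + bandX μ (w / 2 + ((ω.2.1 : ℕ) : ℝ) * w) +
            bandX μ (w / 2 + ((ω.2.2 : ℕ) : ℝ) * w) - 2 * π * (G 0 : ℝ)| ≤ 4 * Dc * w ∧
        |bandY μ (w / 2 + ((ω₁ : ℕ) : ℝ) * w) + bandY μ (w / 2 + ((ω.1 : ℕ) : ℝ) * w) + bandY μ (w / 2 + ((ω.2.1 : ℕ) : ℝ) * w) +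
            bandY μ (w / 2 + ((ω.2.2 : ℕ) : ℝ) * w) - 2 * π * (G 1 : ℝ)| ≤ 4 * Dc * w)).card : ℝ)) ≤
        C₀ * ((((Finset.range (sectorCount n) ×ˢ Finset.range (sectorCount n)).filter fun p : ℕ × ℕ =>
          |hfun μ (w / 2 + ((ω₁ : ℕ) : ℝ) * w) (w / 2 + p.1 * w) (w / 2 + p.2 * w)| ≤ 16 * Dc * w).card : ℝ)) := by
      refine card_prod3_le (N := sectorCount n)
        (Q := fun i c' d => |bandX μ (w / 2 + ((ω₁ : ℕ) : ℝ) * w) + bandX μ (w / 2 + i * w) + bandX μ (w / 2 + c' * w) + bandX μ (w / 2 + d * w) - 2 * π * (G 0 : ℝ)| ≤ 4 * Dc * w ∧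
          |bandY μ (w / 2 + ((ω₁ : ℕ) : ℝ) * w) + bandY μ (w / 2 + i * w) + bandY μ (w / 2 + c' * w) + bandY μ (w / 2 + d * w) - 2 * π * (G 1 : ℝ)| ≤ 4 * Dc * w)
        (R := fun i c' => |hfun μ (w / 2 + ((ω₁ : ℕ) : ℝ) * w) (w / 2 + i * w) (w / 2 + c' * w)| ≤ 16 * Dc * w) hC₀pos.le ?_ ?_
      · intro i c' hi hc'
        have hbox := card_grid_in_box_le B hμab hwpos hNw hr (N := sectorCount n)
          (x := 2 * π * (G 0 : ℝ) - bandX μ (w / 2 + ((ω₁ : ℕ) : ℝ) * w) - bandX μ (w / 2 + i * w) - bandX μ (w / 2 + c' * w))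
          (y := 2 * π * (G 1 : ℝ) - bandY μ (w / 2 + ((ω₁ : ℕ) : ℝ) * w) - bandY μ (w / 2 + i * w) - bandY μ (w / 2 + c' * w))
        have heq : ((Finset.range (sectorCount n)).filter fun d : ℕ =>
            |bandX μ (w / 2 + ((ω₁ : ℕ) : ℝ) * w) + bandX μ (w / 2 + i * w) + bandX μ (w / 2 + c' * w) + bandX μ (w / 2 + d * w) - 2 * π * (G 0 : ℝ)| ≤ 4 * Dc * w ∧
            |bandY μ (w / 2 + ((ω₁ : ℕ) : ℝ) * w) + bandY μ (w / 2 + i * w) + bandY μ (w / 2 + c' * w) + bandY μ (w / 2 + d * w) - 2 * π * (G 1 : ℝ)| ≤ 4 * Dc * w) =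
            ((Finset.range (sectorCount n)).filter fun d : ℕ =>
            |bandX μ (w / 2 + d * w) - (2 * π * (G 0 : ℝ) - bandX μ (w / 2 + ((ω₁ : ℕ) : ℝ) * w) - bandX μ (w / 2 + i * w) - bandX μ (w / 2 + c' * w))| ≤ 4 * Dc * w ∧
            |bandY μ (w / 2 + d * w) - (2 * π * (G 1 : ℝ) - bandY μ (w / 2 + ((ω₁ : ℕ) : ℝ) * w) - bandY μ (w / 2 + i * w) - bandY μ (w / 2 + c' * w))| ≤ 4 * Dc * w) := by
          refine Finset.filter_congr fun d _ => ?_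
          rw [show bandX μ (w / 2 + ((ω₁ : ℕ) : ℝ) * w) + bandX μ (w / 2 + i * w) + bandX μ (w / 2 + c' * w) + bandX μ (w / 2 + d * w) - 2 * π * (G 0 : ℝ) =
            bandX μ (w / 2 + d * w) - (2 * π * (G 0 : ℝ) - bandX μ (w / 2 + ((ω₁ : ℕ) : ℝ) * w) - bandX μ (w / 2 + i * w) - bandX μ (w / 2 + c' * w)) by ring,
            show bandY μ (w / 2 + ((ω₁ : ℕ) : ℝ) * w) + bandY μ (w / 2 + i * w) + bandY μ (w / 2 + c' * w) + bandY μ (w / 2 + d * w) - 2 * π * (G 1 : ℝ) =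
            bandY μ (w / 2 + d * w) - (2 * π * (G 1 : ℝ) - bandY μ (w / 2 + ((ω₁ : ℕ) : ℝ) * w) - bandY μ (w / 2 + i * w) - bandY μ (w / 2 + c' * w)) by ring]
        rw [heq]
        refine hbox.trans (le_of_eq ?_)
        rw [hC₀]; field_simp
      · intro i c' d hi hc' hd hQ
        have := abs_hfun_le_of_sum B hμab hQ.1 hQ.2
        linarith
    -- Step 3: the two-dimensional count
    have hP := hcount μ hμab hlo hhi (w / 2 + ((ω₁ : ℕ) : ℝ) * w) w (sectorCount n) (2 ^ n) n hwpos hw1 hNw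
      (by push_cast; exact h2n) hNeq h2n h2δ
    clear hcount
    -- Step 4: arithmetic
    have hlogN : Real.log (sectorCount n : ℕ) ≤ (n : ℝ) + 1 := by rw [hNreal]; exact log_two_mul_two_pow_le n
    have hwinv : 1 / w = 2 ^ n / π := by rw [← h2n]; field_simp
    have e1 := Finset.card_le_card hsub
    have e1' : ((((Finset.univ : Finset (Fin (sectorCount n) × Fin (sectorCount n) × Fin (sectorCount n))).filter (fun ω => ∃ k : Fin 4 → Fin 2 → ℝ,
        (∀ j i, |k j i| < Real.pi) ∧ (∀ j, |sqDispersion (k j) - μ| ≤ c * w) ∧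
        sectorIndex n (Complex.arg (⟨k 0 0, k 0 1⟩ : ℂ)) = (ω₁ : ℕ) ∧
        sectorIndex n (Complex.arg (⟨k 1 0, k 1 1⟩ : ℂ)) = (ω.1 : ℕ) ∧
        sectorIndex n (Complex.arg (⟨k 2 0, k 2 1⟩ : ℂ)) = (ω.2.1 : ℕ) ∧
        sectorIndex n (Complex.arg (⟨k 3 0, k 3 1⟩ : ℂ)) = (ω.2.2 : ℕ) ∧ (∀ i, ∑ j, k j i = 2 * Real.pi * (G i : ℝ)))).card : ℝ)) ≤
        K₂ * 2 ^ n * ((n : ℝ) + 1) := by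
      have e2 : Kp * ((n : ℝ) + 2 + Real.log (sectorCount n : ℕ)) / w ≤ Kp * (3 * ((n : ℝ) + 1)) / w := by
        apply div_le_div_of_nonneg_right _ hwpos.le
        apply mul_le_mul_of_nonneg_left _ hKp.le
        linarith only [hlogN]
      have e3 : Kp * (3 * ((n : ℝ) + 1)) / w = Kp * 3 / π * 2 ^ n * ((n : ℝ) + 1) := by
        rw [div_eq_mul_one_div _ w, hwinv]; ring
      have e4 : C₀ * (Kp * 3 / π * 2 ^ n * ((n : ℝ) + 1)) = K₂ * 2 ^ n * ((n : ℝ) + 1) := by rw [hK₂]; ring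
      calc _ ≤ _ := by exact_mod_cast e1
        _ ≤ C₀ * (Kp * ((n : ℝ) + 2 + Real.log (sectorCount n : ℕ)) / w) := hT'le.trans (mul_le_mul_of_nonneg_left hP hC₀pos.le)
        _ ≤ C₀ * (Kp * (3 * ((n : ℝ) + 1)) / w) := mul_le_mul_of_nonneg_left e2 hC₀pos.le
        _ = K₂ * 2 ^ n * ((n : ℝ) + 1) := by rw [e3, e4]
    refine e1'.trans ?_
    have : 0 ≤ K₁ * 2 ^ n * ((n : ℝ) + 1) := by positivity
    linarith only [this]
  · -- small `n`: `2ⁿ < π / w₀`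
    clear hcount
    push Not at hwle
    have h2nlt : (2 : ℝ) ^ n ≤ π / w₀ := by
      rw [le_div_iff₀ hw₀pos, ← h2n]
      exact mul_le_mul_of_nonneg_left hwle.le h2npos.le
    have hbound : (sectorCount n : ℝ) ^ 3 ≤ K₁ * 2 ^ n := by
      rw [hNreal, hK₁]
      have hsq : ((2 : ℝ) ^ n) ^ 2 ≤ (π / w₀) ^ 2 := pow_le_pow_left₀ h2npos.le h2nlt 2
      have e : (2 * (2 : ℝ) ^ n) ^ 3 = 8 * ((2 : ℝ) ^ n) ^ 2 * 2 ^ n := by ring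
      rw [e]
      exact mul_le_mul_of_nonneg_right (mul_le_mul_of_nonneg_left hsq (by norm_num)) h2npos.le
    refine (htriv _).trans (hbound.trans ?_)
    have h1 : K₁ * 2 ^ n ≤ (K₁ + K₂) * 2 ^ n := mul_le_mul_of_nonneg_right (by linarith only [hK₂pos]) h2npos.le
    have h2 : (K₁ + K₂) * 2 ^ n ≤ (K₁ + K₂) * 2 ^ n * ((n : ℝ) + 1) :=
      le_mul_of_one_le_right (by positivity) (by linarith only [(by positivity : (0:ℝ) ≤ n)])
    linarith only [h1, h2]

/-- **(a′) Inclusion of the counted sets**: for every fixed `c > 0` and compact level range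
`[μ₁, μ₂] ⊂ (-4, 0)`, the constant `K` of `klsc_fourSectorCount_thickShell` bounds the four-sector
count for ANY prescription of the leg supports `P j` (`j = 1, …, 4`) contained, on the open square
`(-π, π)²`, in the free shell `|ε₀ - μ| ≤ c·w` — e.g. the supports of the scale-`h` sector
propagators of an interacting dispersion `ε_h` (BGM 2006 App. A2: `A_h(ε_h) ⊂ A_h(ε₀;` thicker
shell`)`). The supports may depend on `μ`, `n`, the leg, anything: only the inclusion is used. -/
theorem klsc_fourSectorCount_of_subset_shell (c : ℝ) (hc : 0 < c) :
    ∀ μ₁ μ₂ : ℝ, -4 < μ₁ → μ₁ ≤ μ₂ → μ₂ < 0 → ∃ K : ℝ, 0 < K ∧ ∀ μ ∈ Set.Icc μ₁ μ₂,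
      ∀ (n : ℕ) (G : Fin 2 → ℤ) (ω₁ : Fin (sectorCount n)) (P : Fin 4 → (Fin 2 → ℝ) → Prop),
        (∀ j (k : Fin 2 → ℝ), (∀ i, |k i| < Real.pi) → P j k → |sqDispersion k - μ| ≤ c * sectorWidth n) →
        (((Finset.univ : Finset (Fin (sectorCount n) × Fin (sectorCount n) × Fin (sectorCount n))).filter
          (fun ω => ∃ k : Fin 4 → Fin 2 → ℝ, (∀ j i, |k j i| < Real.pi) ∧
            (∀ j, P j (k j)) ∧
            sectorIndex n (Complex.arg (⟨k 0 0, k 0 1⟩ : ℂ)) = (ω₁ : ℕ) ∧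
            sectorIndex n (Complex.arg (⟨k 1 0, k 1 1⟩ : ℂ)) = (ω.1 : ℕ) ∧
            sectorIndex n (Complex.arg (⟨k 2 0, k 2 1⟩ : ℂ)) = (ω.2.1 : ℕ) ∧
            sectorIndex n (Complex.arg (⟨k 3 0, k 3 1⟩ : ℂ)) = (ω.2.2 : ℕ) ∧
            (∀ i, ∑ j, k j i = 2 * Real.pi * (G i : ℝ)))).card : ℝ) ≤ K * 2 ^ n * ((n : ℝ) + 1) := by
  intro μ₁ μ₂ hμ₁ h12 hμ₂
  obtain ⟨K, hK, hcount⟩ := klsc_fourSectorCount_thickShell c hc μ₁ μ₂ hμ₁ h12 hμ₂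
  refine ⟨K, hK, fun μ hμ n G ω₁ P hP => ?_⟩
  refine le_trans ?_ (hcount μ hμ n G ω₁)
  refine Nat.cast_le.2 (Finset.card_le_card fun ω hω => ?_)
  rw [Finset.mem_filter] at hω ⊢
  obtain ⟨-, k, hk, hPk, h0, h1, h2, h3, hsum⟩ := hω
  exact ⟨Finset.mem_univ _, k, hk, fun j => hP j (k j) (hk j) (hPk j), h0, h1, h2, h3, hsum⟩

/-- **(b) The perturbed-dispersion form** (Benfatto–Giuliani–Mastropietro 2006, Lemma 3.1 and
App. A2 for the moving Fermi curve of `ε_h`; applicable where the cumulative shift fits inside a thick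
free shell, `t + δ ≤ c·w` — the ultraviolet part of the trajectory, module docstring SCOPE):
for every fixed `c > 0` and compact level range `[μ₁, μ₂] ⊂ (-4, 0)` there is `K` such that for
every dispersion `ε'` on the open square with `sup_{(-π,π)²} |ε' - ε₀| ≤ δ` and every shell
thickness `t` with `t + δ ≤ c·w`, `w = π/2ⁿ`, the number of sector triples of width `w`
admitting momenta of the `ε'`-shell `|ε' - μ| ≤ t` in the prescribed sectors with
`k₁ + k₂ + k₃ + k₄ = 2πG` is at most `K·2ⁿ·(n+1)`, uniformly in `ε'`, `t`, `δ`, `G` and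
`μ ∈ [μ₁, μ₂]` — since `{|ε' - μ| ≤ t} ⊂ {|ε₀ - μ| ≤ t + δ} ⊂ {|ε₀ - μ| ≤ c·w}`. -/
theorem klsc_fourSectorCount_perturbed (c : ℝ) (hc : 0 < c) :
    ∀ μ₁ μ₂ : ℝ, -4 < μ₁ → μ₁ ≤ μ₂ → μ₂ < 0 → ∃ K : ℝ, 0 < K ∧ ∀ μ ∈ Set.Icc μ₁ μ₂,
      ∀ (n : ℕ) (G : Fin 2 → ℤ) (ω₁ : Fin (sectorCount n)) (ε' : (Fin 2 → ℝ) → ℝ) (t δ : ℝ),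
        (∀ k : Fin 2 → ℝ, (∀ i, |k i| < Real.pi) → |ε' k - sqDispersion k| ≤ δ) →
        t + δ ≤ c * sectorWidth n →
        (((Finset.univ : Finset (Fin (sectorCount n) × Fin (sectorCount n) × Fin (sectorCount n))).filter
          (fun ω => ∃ k : Fin 4 → Fin 2 → ℝ, (∀ j i, |k j i| < Real.pi) ∧
            (∀ j, |ε' (k j) - μ| ≤ t) ∧
            sectorIndex n (Complex.arg (⟨k 0 0, k 0 1⟩ : ℂ)) = (ω₁ : ℕ) ∧
            sectorIndex n (Complex.arg (⟨k 1 0, k 1 1⟩ : ℂ)) = (ω.1 : ℕ) ∧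
            sectorIndex n (Complex.arg (⟨k 2 0, k 2 1⟩ : ℂ)) = (ω.2.1 : ℕ) ∧
            sectorIndex n (Complex.arg (⟨k 3 0, k 3 1⟩ : ℂ)) = (ω.2.2 : ℕ) ∧
            (∀ i, ∑ j, k j i = 2 * Real.pi * (G i : ℝ)))).card : ℝ) ≤ K * 2 ^ n * ((n : ℝ) + 1) := by
  intro μ₁ μ₂ hμ₁ h12 hμ₂
  obtain ⟨K, hK, hcount⟩ := klsc_fourSectorCount_of_subset_shell c hc μ₁ μ₂ hμ₁ h12 hμ₂
  refine ⟨K, hK, fun μ hμ n G ω₁ ε' t δ hε' htδ => ?_⟩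
  refine hcount μ hμ n G ω₁ (fun _ k => |ε' k - μ| ≤ t) fun j k hk hPk => ?_
  have h1 := hε' k hk
  calc |sqDispersion k - μ| = |(ε' k - μ) - (ε' k - sqDispersion k)| := by ring_nf
    _ ≤ |ε' k - μ| + |ε' k - sqDispersion k| := abs_sub _ _
    _ ≤ t + δ := add_le_add hPk h1
    _ ≤ c * sectorWidth n := htδ

end Summit.HubbardSuperconductivity.HubbardSuperconductivity.Theorems

end
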